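import Summits.ValiantsHypothesis.ValiantsHypothesis.Theorems.SymPencilPerFourInnerRankTenFamily
import Summits.ValiantsHypothesis.ValiantsHypothesis.Theorems.SymPencilPerFourInnerRankRankOne

/-!
# Route `SymPencil` — inner rank of the `2 | 2` row split of `per_4`: the `y₂`-blocks of the
# `a`-part and of the `b`-part cannot both have rank `≤ 1`
# (`--supports` stmt-ValiantsHypothesis-5674 `SdcSuperquadratic`; (8,8) column, isotropic-kernel route,
# step (B5)(ii) of memo `NOTE-p6g15-5674-IR12-reduction.md` §10)

For a joint family `Σ_r c_r t_r((a,b),(y₂,y₃))² = per (a; b; y₂; y₃)` (characteristic `0`, any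
number of squares): `y₂ ↦ (t_r((𝟙,𝟙),(y₂,0)))_r` is injective (`injective_slot_ones`, by
polarisation and `SymPencilPerFourInnerRankRows.eq_zero_of_per_ones`), hence of rank `4`; so the
two alternatives "(iA) all `A₂(a)` have rank `≤ 1`" and "(iB) all `B₂(b)` have rank `≤ 1`" of
`…Slots` cannot hold together (`not_both_fst`), since `A₂(𝟙) + B₂(𝟙)` would have rank `≤ 2`.
With the `a ↔ b`, `y₂ ↔ y₃`, `(a,b) ↔ (y₂,y₃)` symmetries this gives the pairings
`(iA ∧ iiB) ∨ (iiA ∧ iB)` and `(iY₂ ∧ iiY₃) ∨ (iiY₂ ∧ iY₃)` of memo §10.  Honest framing: a step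
in a conditional reduction of the cells `(8,8,10)`, `(8,8,11)`; nothing about the window, the
crux or `VP ≠ VNP`.  No definitions, no named facts. [folklore]
-/

noncomputable section

-- single-conjunct layout: Sub = Summit, duplicated namespace component intended
set_option linter.dupNamespace false

namespace Summit.ValiantsHypothesis.ValiantsHypothesis.Theorems.SymPencilPerFourInnerRankNotBoth

open Matrix Finset Module
open Summit.ValiantsHypothesis.ValiantsHypothesis.Theorems.SymPencilPerFourInnerRankRows
open Summit.ValiantsHypothesis.ValiantsHypothesis.Theorems.SymPencilPerFourInnerRankTenFamily
open Summit.ValiantsHypothesis.ValiantsHypothesis.Theorems.SymPencilPerFourInnerRankRankOne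

variable {K : Type*} [Field K] {ι : Type*}

/-- Vanishing `2 × 2` minors ⇒ the range has dimension `≤ 1`. [folklore] -/
theorem finrank_range_le_one_of_minors {X : Type*} [AddCommGroup X] [Module K X]
    (N : X →ₗ[K] (ι → K))
    (hmin : ∀ (x x' : X) (r r' : ι), N x r * N x' r' = N x' r * N x r') :
    finrank K (LinearMap.range N) ≤ 1 := by
  by_cases hz : ∀ x, N x = 0
  · have : LinearMap.range N = ⊥ := by
      rw [eq_bot_iff]; rintro _ ⟨x, rfl⟩; rw [hz x]; exact Submodule.zero_mem _
    rw [this, finrank_bot]; exact zero_le_one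
  push Not at hz
  obtain ⟨x₀, hx₀⟩ := hz
  obtain ⟨r₀, hr₀⟩ : ∃ r, N x₀ r ≠ 0 := by
    by_contra h; push Not at h; exact hx₀ (funext h)
  have hle : LinearMap.range N ≤ K ∙ N x₀ := by
    rintro _ ⟨x, rfl⟩
    obtain ⟨s, hs⟩ := exists_smul_of_minors N hmin x₀ r₀ hr₀ x
    rw [hs]; exact Submodule.smul_mem _ _ (Submodule.mem_span_singleton_self _)
  exact (Submodule.finrank_mono hle).trans (finrank_span_singleton hx₀).le

/-- **`y₂ ↦ T(𝟙,𝟙)(y₂,0)` is injective.** [folklore] -/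
theorem injective_slot_ones [Fintype ι] [CharZero K] (c : ι → K)
    (t : ι → (((Fin 4 → K) × (Fin 4 → K)) →ₗ[K] ((Fin 4 → K) × (Fin 4 → K)) →ₗ[K] K))
    (hJ : ∀ a b y₂ y₃ : Fin 4 → K,
      ∑ r, c r * (t r (a, b) (y₂, y₃)) ^ 2 = (Matrix.of ![a, b, y₂, y₃]).permanent)
    (x : Fin 4 → K) (hx : ∀ r, t r ((fun _ => 1), (fun _ => 1)) (x, 0) = 0) : x = 0 := by
  refine eq_zero_of_per_ones x fun w => ?_
  have h := polar c t hJ (fun _ => 1) (fun _ => 1) x 0 0 w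
  rw [per_zero_row₂, add_zero] at h
  rw [← h]
  simp [hx]

/-- **(iA) and (iB) cannot both hold.** [folklore] -/
theorem not_both_fst [Fintype ι] [CharZero K] (c : ι → K)
    (t : ι → (((Fin 4 → K) × (Fin 4 → K)) →ₗ[K] ((Fin 4 → K) × (Fin 4 → K)) →ₗ[K] K))
    (hJ : ∀ a b y₂ y₃ : Fin 4 → K,
      ∑ r, c r * (t r (a, b) (y₂, y₃)) ^ 2 = (Matrix.of ![a, b, y₂, y₃]).permanent)
    (hA : ∀ (a x x' : Fin 4 → K) (r r' : ι),
      t r (a, 0) (x, 0) * t r' (a, 0) (x', 0) - t r (a, 0) (x', 0) * t r' (a, 0) (x, 0) = 0)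
    (hB : ∀ (b x x' : Fin 4 → K) (r r' : ι),
      t r (0, b) (x, 0) * t r' (0, b) (x', 0) - t r (0, b) (x', 0) * t r' (0, b) (x, 0) = 0) :
    False := by
  set e : Fin 4 → K := fun _ => 1 with he
  let N₁ : (Fin 4 → K) →ₗ[K] (ι → K) :=
    (LinearMap.pi fun r => t r (e, 0)) ∘ₗ LinearMap.inl K (Fin 4 → K) (Fin 4 → K)
  let N₂ : (Fin 4 → K) →ₗ[K] (ι → K) :=
    (LinearMap.pi fun r => t r (0, e)) ∘ₗ LinearMap.inl K (Fin 4 → K) (Fin 4 → K)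
  have hN₁ : ∀ x r, N₁ x r = t r (e, 0) (x, 0) := fun x r => rfl
  have hN₂ : ∀ x r, N₂ x r = t r (0, e) (x, 0) := fun x r => rfl
  have h1 : finrank K (LinearMap.range N₁) ≤ 1 :=
    finrank_range_le_one_of_minors N₁ fun x x' r r' => by
      simp only [hN₁]; linear_combination hA e x x' r r'
  have h2 : finrank K (LinearMap.range N₂) ≤ 1 :=
    finrank_range_le_one_of_minors N₂ fun x x' r r' => by
      simp only [hN₂]; linear_combination hB e x x' r r'
  -- `N₁ + N₂ = (x ↦ T(𝟙,𝟙)(x,0))` is injective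
  have hsum : ∀ x r, (N₁ + N₂) x r = t r (e, e) (x, 0) := fun x r => by
    have : ((e, e) : (Fin 4 → K) × (Fin 4 → K)) = (e, 0) + (0, e) := by simp
    rw [LinearMap.add_apply, Pi.add_apply, hN₁, hN₂, this, map_add, LinearMap.add_apply]
  have hinj : Function.Injective (N₁ + N₂) := by
    rw [← LinearMap.ker_eq_bot, LinearMap.ker_eq_bot']
    intro x hx
    exact injective_slot_ones c t hJ x fun r => by rw [← hsum, hx]; rfl
  have h4 : finrank K (LinearMap.range (N₁ + N₂)) = 4 := by
    rw [LinearMap.finrank_range_of_inj hinj, finrank_fintype_fun_eq_card, Fintype.card_fin]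
  have hle : LinearMap.range (N₁ + N₂) ≤ LinearMap.range N₁ ⊔ LinearMap.range N₂ := by
    rintro _ ⟨x, rfl⟩
    rw [LinearMap.add_apply]
    exact Submodule.add_mem_sup (LinearMap.mem_range_self _ _) (LinearMap.mem_range_self _ _)
  have := (Submodule.finrank_mono hle).trans (Submodule.finrank_add_le_finrank_add_finrank _ _)
  omega

end Summit.ValiantsHypothesis.ValiantsHypothesis.Theorems.SymPencilPerFourInnerRankNotBoth

end
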